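import Summits.AtomisticToContinuum.FouriersLaw.Theorems.HiddenChargeMazurBridgeGlue

/-!
# `HiddenChargeMazur.Assembly` — PROVED

Route `AtomisticToContinuum/FouriersLaw/HiddenChargeMazur` (refutation-shaped), assembly item
`stmt-AtomisticToContinuum-12124` (`Assembly`):

  `StaticKubo → ThomsonBound → DressedCharge → OddChargeExists → ¬ FouriersLaw`,

unconditional: the route's glue `BridgeGlue` is proved in
`Theorems/HiddenChargeMazurBridgeGlue.lean` (`hiddenChargeMazur_bridgeGlue_proof`) and fed to the
planner-authored deciding theorem `closes` of the route file.  Standard axioms.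
-/

namespace Summit.AtomisticToContinuum.FouriersLaw.Theorems

/-- Settles `stmt-AtomisticToContinuum-12124` (assembly of route `HiddenChargeMazur`): the static
open-chain Kubo identity `StaticKubo`, the one-sided Thomson bound `ThomsonBound`, the dressed
charge `DressedCharge` and the (disbelieved) existence clause `OddChargeExists` refute the
sub-problem statement `FouriersLaw`.  Proof: the route's deciding theorem `closes` fed with the
glue `hiddenChargeMazur_bridgeGlue_proof` (after unfolding `Assembly`). [folklore] -/
theorem hiddenChargeMazur_assembly_proof :
    Summit.AtomisticToContinuum.FouriersLaw.Theses.HiddenChargeMazur.Assembly := by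
  unfold Summit.AtomisticToContinuum.FouriersLaw.Theses.HiddenChargeMazur.Assembly
  intro hK hT hD hE
  -- the route (CLOSED·refuted 2026-08-17) no longer carries its deciding theorem `closes`; its three
  -- lines of logic are inlined: the glue gives `OpenMazurBridge`, `OddChargeExists` supplies the
  -- parameters and the charge, and `FouriersLaw` at those parameters contradicts the bridge.
  have hB : Summit.AtomisticToContinuum.FouriersLaw.Theses.HiddenChargeMazur.OpenMazurBridge :=
    hiddenChargeMazur_bridgeGlue_proof hK hT hD
  obtain ⟨ω₂, lam, β, γ, T, hω, hl, hβ, hγ, hTpos, hcharge⟩ := hE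
  intro hFL
  exact hB ω₂ lam β γ T hω hl hβ hγ hTpos _ rfl (hcharge _ rfl) (hFL ω₂ lam β γ hω hl hβ hγ)

end Summit.AtomisticToContinuum.FouriersLaw.Theorems
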